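import Literature.AlgebraicGeometry.Frobenioids.PrimesEquivPreStep
import Literature.AlgebraicGeometry.Frobenioids.Thm42SubII
import HarnessLib

/-!
# [FrdI] Theorem 4.2 (ii): sub-lemma T42-L10 `PsiPrimeFunctorialPreStep` DISCHARGED

Mochizuki, *The geometry of Frobenioids I: the general theory*, Kyushu J. Math. **62** (2008)
293–400, §4, Theorem 4.2 (ii), proof p. 80 l. 44 – p. 81 l. 4 [cite: MochizukiFrdI2008, Thm. 4.2 (ii) p.80].
PROOF-ONLY one-line closer (seat abc-iut-w4-d090) of the slot `FrdI.T42.PsiPrimeFunctorialPreStep` of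
`Thm42SubII.lean` (abc-iut-L1-t14, sub-DAG `plan/L1/SUBDAG-FrdI-Thm42-Thm49.md` row
`FrdI:Thm4.2(ii)/T42-L10`) by `PreFrobenioid.primesEquiv_naturality_preStep_mem` (`PrimesEquivPreStep.lean`).
The hypothesis "`Ψ` preserves primary pre-steps" of the slot is not needed for the pre-step case.
No statement is restated or strengthened; [FrdI] is refereed and undisputed.
-/

namespace Literature.AlgebraicGeometry.Frobenioids

namespace FrdI.T42

open CategoryTheory Opposite

/-- **T42-L10 `PsiPrimeFunctorialPreStep` DISCHARGED** (p. 80 l. 44 – p. 81 l. 4): the family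
`e = Ψ^Prime` is compatible with `Prime(Φ_i(−))` along every pre-step.
[cite: MochizukiFrdI2008, Thm. 4.2 (ii) p.80] -/
theorem psiPrimeFunctorialPreStep_holds : PsiPrimeFunctorialPreStep := by
  intro D₁ _ Φ₁ C₁ _ D₂ _ Φ₂ C₂ _ F₁ F₂ Ψ hS _ e he A A' γ hγ 𝔭 𝔭' hrel
  exact PreFrobenioid.primesEquiv_naturality_preStep_mem Ψ hS.isFrobenioid₁ hS.isFrobenioid₂ hS.perfect₁
    hS.perfect₂ hS.isotropic₁ hS.isotropic₂ hS.perfFactorial₁ hS.perfFactorial₂ hS.preStep_map hS.preStep_inv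
    e he γ hγ 𝔭 𝔭' hrel

end FrdI.T42

end Literature.AlgebraicGeometry.Frobenioids
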